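import Summits.RiemannHypothesis.RiemannHypothesis.Theses.LeeYang
import Summits.RiemannHypothesis.RiemannHypothesis.Theorems.LeeYangLeeyangThesisStubDB
import Summits.RiemannHypothesis.RiemannHypothesis.Theorems.LeeYangLeeyangThesisStubB1
import Summits.RiemannHypothesis.RiemannHypothesis.Theorems.LeeYangLeeyangThesisRealToComplex
import Literature.NumberTheory.LFunctions.RiemannXi

/-!
# Skeleton v3 — crux `LeeYang.LeeyangThesis` (stmt-RiemannHypothesis-0451), line `Sketch`
(card `telegraph-string`, ideator 1; lead prover-line-stmt-RiemannHypothesis-0451-0, 2026-08-16)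

**The line.** A nearest-neighbour ferromagnetic chain (spins `σ₀ … σ_{N-1}`, bond couplings
`K_j ≥ 0`, weights `w_j ≥ 0`, zero field) IS a Kreĭn string with piecewise-constant NON-DECREASING
density: piece `j` has density `P_j²` and length `ℓ_j = w_j / P_j`, where `P_{j+1} = P_j / tanh K_j`,
and `E e^{h M} = φ(x_end, -h²)` for the string's Neumann solution `φ` (`KreinString.phi`). Hence every
law whose two-sided Laplace transform is the end value `lim_{x → L⁻} φ(x, -h²)` of a finite-length
string with non-decreasing density (`massMeasure = (ρ dy)|(-∞,L)`, `ρ` monotone on `(-∞, L)`, zero on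
`(-∞, 0)`; `m(L-) = ∞` allowed) is an Ising limit law (B1), and the crux X = `LeeyangThesis` follows
from the single RH-strength existence statement C⁺, now in REAL-AXIS form (`stub_xiStringReal`):
`ξ(1/2 + r/2)/ξ(1/2)`, `r ∈ ℝ`, is the real end value of such a string.

History. v1 (7 stubs, 2026-08-16T12:25Z) → wave 1 landed `stub_dB` (p102373), `stub_phiMono`
(p102362), `stub_stringSteps` (p102980), `stub_stepApprox` (p104552 + Aux p103674, worker-added
`stub_stepApprox_grid`), `stub_chainMarkov` (p105980; churn-free twin `stub_chainMarkovPlain` p110134/p112725);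
the lead landed `stub_B1` (glue: Lévy + Gaussian average, Theorems/LeeYangLeeyangThesisStubB1.lean, p114373) and the RH-free reduction
`stub_realToComplex` (Theorems/LeeYangLeeyangThesisRealToComplex.lean, p106861): real end values that
trace an entire function extend to complex end values (Picard-coefficient domination, locally uniform
limit, identity theorem). v3 = this file: the complex-`h` transfer `stub_xiString` of v1 is RESHAPED
to its real-axis form `stub_xiStringReal` (strictly weaker hypothesis-free statement about
`ξ` on the real axis `σ = 1/2 + r/2`; still RH-strength: it implies X, hence RH).

Composition (`LeeyangThesis_of` concludes the crux BY NAME): `stub_xiStringReal` (OPEN, RH-strength)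
→ `stub_realToComplex` (landed; `F(h) = ξ(1/2 + h/2)/ξ(1/2)` is entire by `differentiable_riemannXi`)
→ `stub_B1` (landed) with the identification `stub_dB` (landed).
-/

noncomputable section

-- the sub-problem path `RiemannHypothesis/RiemannHypothesis` (single-conjunct summit, D-0017) duplicates a namespace
set_option linter.dupNamespace false

open MeasureTheory Filter Topology Complex
open scoped ENNReal

namespace Summit.RiemannHypothesis.RiemannHypothesis.Theorems.LeeYangTelegraphString

open Literature.Probability.LatticeModels Literature.NumberTheory.LFunctions
open Literature.Analysis.InverseSpectral
open Summit.RiemannHypothesis.RiemannHypothesis.Theses.LeeYang (LeeyangThesis)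

/-! ## Composition, parametrised by the real-axis transfer statement -/

/-- `h ↦ ξ(1/2 + h/2)/ξ(1/2)` is entire. [folklore] -/
theorem differentiable_xiRatio :
    Differentiable ℂ fun h : ℂ => riemannXi (1 / 2 + h / 2) / riemannXi (1 / 2) := by
  refine Differentiable.div_const ?_ _
  exact differentiable_riemannXi.comp ((differentiable_const _).add (differentiable_id.div_const _))

/-- **C⁺_real ⇒ X (sorry-free).** If some finite-length Kreĭn string with non-decreasing density has
real end values `ξ(1/2 + r/2)/ξ(1/2)`, then the de Bruijn law is an Ising limit law: real-to-complex
extension (`stub_realToComplex`, the ratio being entire), B1 (`stub_B1`) and the identification of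
the de Bruijn law (`stub_dB`). -/
theorem leeyangThesis_of_xiStringReal
    (h : ∃ (S : KreinString) (L : ℝ) (ρ : ℝ → ℝ), 0 < L ∧ Measurable ρ ∧
      MonotoneOn ρ (Set.Iio L) ∧ (∀ y < 0, ρ y = 0) ∧ S.length = ENNReal.ofReal L ∧
      S.massMeasure = (volume.withDensity fun y => ENNReal.ofReal (ρ y)).restrict (Set.Iio L) ∧
      ∀ r : ℝ, Tendsto (fun x => S.phi (-(r : ℂ) ^ 2) x) S.toEnd
        (𝓝 (riemannXi (1 / 2 + r / 2) / riemannXi (1 / 2)))) :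
    LeeyangThesis := by
  intro ν hν
  obtain ⟨S, L, ρ, hL, hρm, hmono, hρ0, hlen, hmass, hlim⟩ := h
  obtain ⟨hmgf, hmom⟩ := stub_dB ν hν
  have hlimC := stub_realToComplex S (fun h : ℂ => riemannXi (1 / 2 + h / 2) / riemannXi (1 / 2))
    differentiable_xiRatio (fun r => by simpa using hlim r)
  exact stub_B1 S L ρ hL hρm hmono hρ0 hlen hmass ν hmom fun h => by
    rw [hmgf h]; simpa using hlimC h

/-- **C⁺_real is RH-strength (sorry-free certificate).** The real-axis transfer statement implies
the Riemann hypothesis, through X and the route's deciding theorem `Theses.LeeYang.closes`. -/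
theorem riemannHypothesis_of_xiStringReal
    (h : ∃ (S : KreinString) (L : ℝ) (ρ : ℝ → ℝ), 0 < L ∧ Measurable ρ ∧
      MonotoneOn ρ (Set.Iio L) ∧ (∀ y < 0, ρ y = 0) ∧ S.length = ENNReal.ofReal L ∧
      S.massMeasure = (volume.withDensity fun y => ENNReal.ofReal (ρ y)).restrict (Set.Iio L) ∧
      ∀ r : ℝ, Tendsto (fun x => S.phi (-(r : ℂ) ^ 2) x) S.toEnd
        (𝓝 (riemannXi (1 / 2 + r / 2) / riemannXi (1 / 2)))) :
    Summit.RiemannHypothesis :=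
  Summit.RiemannHypothesis.RiemannHypothesis.Theses.LeeYang.closes (leeyangThesis_of_xiStringReal h)

/-! ## C⁺ in real-axis form: the ξ-string (the one open stub) -/

/-- **Stub xiStringReal — the transfer C⁺ of the line, real-axis form (RH-strength; held by the
lead).** There is a Kreĭn string of finite length `L` with mass `ρ(y) dy` on `(-∞, L)` — `ρ`
measurable, NON-DECREASING on `(-∞, L)` (ferromagnetism of the chain = monotonicity of the density =
convexity of the mass), zero on `(-∞, 0)` — whose Neumann solution has REAL end values
`lim_{x → L⁻} φ(x, -r²) = ξ(1/2 + r/2)/ξ(1/2)` for every real `r` ("`σ ↦ ξ(σ)/ξ(1/2)`, `σ ≥ 1/2`, is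
the real transfer function of a string with non-decreasing density"). Since `x ↦ φ(x, -r²)` is real
and non-decreasing, this says `sup_{x < L} φ(x, -r²) = ξ(1/2 + r/2)/ξ(1/2)`. It implies X and RH
(`riemannHypothesis_of_xiStringReal`); the calibration member of the line
(`stub_calMember`: density `1/((L-y)² log²(A/(L-y)))`) shows that such strings DO produce transfer
functions of ξ's growth order `e^{O(r log r)}` inside the Griffiths–Simon class. -/
theorem stub_xiStringReal : ∃ (S : KreinString) (L : ℝ) (ρ : ℝ → ℝ), 0 < L ∧ Measurable ρ ∧
    MonotoneOn ρ (Set.Iio L) ∧ (∀ y < 0, ρ y = 0) ∧ S.length = ENNReal.ofReal L ∧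
    S.massMeasure = (volume.withDensity fun y => ENNReal.ofReal (ρ y)).restrict (Set.Iio L) ∧
    ∀ r : ℝ, Tendsto (fun x => S.phi (-(r : ℂ) ^ 2) x) S.toEnd
      (𝓝 (riemannXi (1 / 2 + r / 2) / riemannXi (1 / 2))) := by
  sorry

/-! ## The crux by name -/

/-- **The line closes the crux.** C⁺ in real-axis form (`stub_xiStringReal`) gives `LeeyangThesis`
by `leeyangThesis_of_xiStringReal`. -/
theorem LeeyangThesis_of : LeeyangThesis :=
  leeyangThesis_of_xiStringReal stub_xiStringReal

end Summit.RiemannHypothesis.RiemannHypothesis.Theorems.LeeYangTelegraphString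

end
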